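import Summits.AtomisticToContinuum.BoseEinsteinCondensation.Theses.BECInsertionCorrector
import Summits.AtomisticToContinuum.BoseEinsteinCondensation.Theorems.StaticResponseBound.Negative.Basic
import Summits.AtomisticToContinuum.BoseEinsteinCondensation.Theorems.StaticResponseBound.Negative.CellToolkit
import Literature.MathematicalPhysics.QuantumManyBody.WeightedCorrector
import Literature.MathematicalPhysics.QuantumManyBody.LangevinGenerator
import Literature.MathematicalPhysics.QuantumManyBody.GroundStateDirichletForm
import Literature.MathematicalPhysics.QuantumManyBody.PeriodicBoseGasImpurityTranslation
import Literature.MathematicalPhysics.QuantumManyBody.LiebYngvasonPoincare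
import Literature.MathematicalPhysics.QuantumManyBody.PeriodicHeatFlowSpectralProofs
import HarnessLib

/-!
# Modulated minimisers on the torus, I: the energy of `θ|Φ|` in real form and admissible
# perturbations (support for stub S3 `ModulationBootstrap`, line `uv-thomson-force-wave`,
# crux `BECInsertionCorrector.StaticResponseBound`, item stmt-AtomisticToContinuum-12057)

Part 1 of 5 of the conditional reduction `stub_modulationBootstrap_of_exists` (part 5): for a real
nonnegative, pointwise non-vanishing periodic trial state `Φ` of finite energy (any measurable pair
profile `w`), the interaction `W = ∑_{i<j} w^per` is a.e. finite on the cell and every trial state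
`Ψ = θ|Φ|` (`θ` real `C¹`) has `E_w(Ψ) = ∫|∇(θ|Φ|)|² + ∫W(θ|Φ|)²` as real Bochner integrals
(`periodicEnergy_eq_ofReal_of_eq_mul`); second-order expansions along `(1 + εζ)|Φ|`
(`integral_gradDot_perturb`, `integral_mul_perturb_sq`); the normalised perturbed states
`c_ε(1 + εζ)|Φ|` are admissible for small `ε` (`exists_perturbedState`, `energy_perturbedState`).

References: [ReedSimonIV1978] §XIII.1 (Rayleigh–Ritz); [Davies1989] §4.2 (ground-state transform).
-/

noncomputable section

namespace Summit.AtomisticToContinuum.BoseEinsteinCondensation.Cruxes.StaticResponseBound.UvThomsonForceWave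

open MeasureTheory Filter Metric
open scoped ENNReal NNReal BigOperators Topology
open Literature.MathematicalPhysics.QuantumManyBody.BoseGas
open Summit.AtomisticToContinuum.BoseEinsteinCondensation.Theses.BECInsertionCorrector
open Summit.AtomisticToContinuum.BoseEinsteinCondensation.Theorems.StaticResponseBound.Negative

variable {N : ℕ} {L : ℝ}

/-! ### Measurability and the modulus of a positive real state -/

/-- The periodic pair interaction `∑_{i<j} w^per(xᵢ - xⱼ)` is Borel measurable for a measurable
profile `w` (as `measurable_periodicInteraction` of `DiluteBoseGasUpperBoundLocalization.lean`,
re-proved to keep the imports light). [folklore] -/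
theorem measurable_periodicInteraction_of {w : ℝ → ℝ≥0∞} (hw : Measurable w) (L : ℝ) :
    Measurable (periodicInteraction (N := N) w L) := by
  have hp : Measurable (periodizedPotential w L) := by
    unfold periodizedPotential
    exact Measurable.tsum fun n => hw.comp (measurable_id.sub_const _).norm
  unfold periodicInteraction
  refine Finset.measurable_sum _ fun i _ => Finset.measurable_sum _ fun j _ => ?_
  exact hp.comp ((measurable_config_apply i).sub (measurable_config_apply j))

/-- For a real nonnegative state (`Ψ = |Ψ|` pointwise) the modulus is the real part. [folklore] -/
theorem norm_eq_re_of_real (Φ : PeriodicTrialState N L) (hreal : ∀ X, Φ.ψ X = (‖Φ.ψ X‖ : ℂ))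
    (X : Config N) : ‖Φ.ψ X‖ = (Φ.ψ X).re := by
  conv_rhs => rw [hreal X]
  rw [Complex.ofReal_re]

/-- The modulus `X ↦ |Φ(X)|` of a real nonnegative periodic `C¹` state is `C¹`. [folklore] -/
theorem contDiff_norm_of_real (Φ : PeriodicTrialState N L) (hreal : ∀ X, Φ.ψ X = (‖Φ.ψ X‖ : ℂ)) :
    ContDiff ℝ 1 fun X => ‖Φ.ψ X‖ := by
  have h : (fun X => ‖Φ.ψ X‖) = fun X => (Φ.ψ X).re := funext (norm_eq_re_of_real Φ hreal)
  rw [h]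
  exact Complex.reCLM.contDiff.comp Φ.contDiff

/-- The kinetic density of a real `C¹` function `G` (cast to `ℂ`) is `|∇G|² = Γ(G, G)`
(adapted from `kineticDensity_ofReal` of `GroundStateFeynmanKacFreeForm.lean`). [folklore] -/
theorem kineticDensity_ofReal_eq_gradDot {G : Config N → ℝ} (hG : Differentiable ℝ G) (X : Config N) :
    kineticDensity (fun Y => ((G Y : ℝ) : ℂ)) X = ENNReal.ofReal (gradDot G G X) := by
  have hder : fderiv ℝ (fun Y => ((G Y : ℝ) : ℂ)) X = Complex.ofRealCLM.comp (fderiv ℝ G X) :=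
    (Complex.ofRealCLM.hasFDerivAt.comp X (hG X).hasFDerivAt).fderiv
  unfold kineticDensity gradDot pderiv
  rw [ENNReal.ofReal_sum_of_nonneg fun i _ => Finset.sum_nonneg fun a _ => mul_self_nonneg _]
  refine Finset.sum_congr rfl fun i _ => ?_
  rw [ENNReal.ofReal_sum_of_nonneg fun a _ => mul_self_nonneg _]
  refine Finset.sum_congr rfl fun a _ => ?_
  rw [coe_nnnorm_sq_eq_ofReal, hder, ContinuousLinearMap.comp_apply, Complex.ofRealCLM_apply,
    Complex.norm_real, Real.norm_eq_abs, sq_abs, sq]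

/-- A continuous function is bounded on the fundamental cell (which lies in a compact ball).
[folklore] -/
theorem exists_bound_on_cellN {θ : Config N → ℝ} (hθ : Continuous θ) (L : ℝ) :
    ∃ M : ℝ, 0 ≤ M ∧ ∀ X ∈ cellN N L, |θ X| ≤ M := by
  obtain ⟨C, hC⟩ := (isCompact_closedBall (0 : Config N) (2 * |L|)).exists_bound_of_continuousOn
    hθ.continuousOn
  refine ⟨max C 0, le_max_right _ _, fun X hX => ?_⟩
  have h := hC X (cellN_subset_closedBall N L hX)
  rw [Real.norm_eq_abs] at h
  exact h.trans (le_max_left _ _)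

/-! ### Finite energy of a positive state: the interaction is a.e. finite on the cell -/

section FiniteEnergy

variable {w : ℝ → ℝ≥0∞} {Φ : PeriodicTrialState N L}

/-- If a pointwise non-vanishing state has finite energy, the periodic interaction is finite
almost everywhere on the fundamental cell. [folklore] -/
theorem ae_periodicInteraction_lt_top (hw : Measurable w) (hpos : ∀ X, Φ.ψ X ≠ 0)
    (hfin : periodicEnergy w Φ ≠ ⊤) :
    ∀ᵐ X ∂(volume.restrict (cellN N L)), periodicInteraction w L X < ⊤ := by
  have hmeas : Measurable fun X => periodicInteraction w L X * ((‖Φ.ψ X‖₊ : ℝ≥0∞)) ^ 2 :=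
    (measurable_periodicInteraction_of hw L).mul
      ((Φ.contDiff.continuous.measurable.nnnorm.coe_nnreal_ennreal).pow_const _)
  have hle : (∫⁻ X in cellN N L, periodicInteraction w L X * ((‖Φ.ψ X‖₊ : ℝ≥0∞)) ^ 2) ≠ ⊤ :=
    ne_top_of_le_ne_top hfin (lintegral_mono fun X => le_add_self)
  filter_upwards [ae_lt_top hmeas hle] with X hX
  have h0 : ((‖Φ.ψ X‖₊ : ℝ≥0∞)) ^ 2 ≠ 0 :=
    pow_ne_zero _ (by rw [ne_eq, ENNReal.coe_eq_zero, nnnorm_eq_zero]; exact hpos X)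
  rcases ENNReal.mul_lt_top_iff.1 hX with h | h | h
  · exact h.1
  · rw [h]; exact ENNReal.zero_lt_top
  · exact absurd h h0

/-- For a pointwise non-vanishing finite-energy state, the real potential energy density
`W.toReal |Φ|²` is integrable on the cell. [folklore] -/
theorem integrableOn_toReal_interaction_mul_norm_sq (hw : Measurable w)
    (hfin : periodicEnergy w Φ ≠ ⊤) :
    IntegrableOn (fun X => (periodicInteraction w L X).toReal * ‖Φ.ψ X‖ ^ 2) (cellN N L) := by
  have hmeasU : Measurable fun X => (periodicInteraction w L X).toReal * ‖Φ.ψ X‖ ^ 2 :=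
    (measurable_periodicInteraction_of hw L).ennreal_toReal.mul
      ((Φ.contDiff.continuous.norm.measurable).pow_const _)
  have hnn : ∀ X, 0 ≤ (periodicInteraction w L X).toReal * ‖Φ.ψ X‖ ^ 2 := fun X =>
    mul_nonneg ENNReal.toReal_nonneg (sq_nonneg _)
  refine ⟨hmeasU.aestronglyMeasurable, ?_⟩
  rw [hasFiniteIntegral_iff_ofReal (ae_of_all _ hnn)]
  have hle : (∫⁻ X in cellN N L, periodicInteraction w L X * ((‖Φ.ψ X‖₊ : ℝ≥0∞)) ^ 2) ≠ ⊤ :=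
    ne_top_of_le_ne_top hfin (lintegral_mono fun X => le_add_self)
  refine lt_of_le_of_lt (lintegral_mono fun X => ?_) (lt_top_iff_ne_top.2 hle)
  rw [ENNReal.ofReal_mul ENNReal.toReal_nonneg, coe_nnnorm_sq_eq_ofReal]
  exact mul_le_mul' ENNReal.ofReal_toReal_le le_rfl

end FiniteEnergy

/-! ### The energy of a real multiple `θ|Φ|` of a positive state, in real form -/

section RealForm

variable {w : ℝ → ℝ≥0∞} {Φ : PeriodicTrialState N L}

/-- **Real form of the energy.** Let `Φ` be a real nonnegative, pointwise non-vanishing periodic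
state of finite energy and `Ψ` a periodic state with `Ψ = θ|Φ|` for a real `C¹` function `θ`.
Then `E_w(Ψ) = ∫_cell |∇(θ|Φ|)|² + ∫_cell W (θ|Φ|)²` with `W = (∑_{i<j} w^per).toReal` (real Bochner
integrals; the interaction is a.e. finite on the cell by the finite energy of `Φ`). [folklore] -/
theorem periodicEnergy_eq_ofReal_of_eq_mul (hw : Measurable w) (hreal : ∀ X, Φ.ψ X = (‖Φ.ψ X‖ : ℂ))
    (hpos : ∀ X, Φ.ψ X ≠ 0) (hfin : periodicEnergy w Φ ≠ ⊤) (Ψ : PeriodicTrialState N L)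
    {θ : Config N → ℝ} (hθ : ContDiff ℝ 1 θ) (hΨ : ∀ X, Ψ.ψ X = ((θ X * ‖Φ.ψ X‖ : ℝ) : ℂ)) :
    periodicEnergy w Ψ = ENNReal.ofReal
      ((∫ X in cellN N L, gradDot (fun Y => θ Y * ‖Φ.ψ Y‖) (fun Y => θ Y * ‖Φ.ψ Y‖) X) +
        ∫ X in cellN N L, (periodicInteraction w L X).toReal * (θ X * ‖Φ.ψ X‖) ^ 2) := by
  set G : Config N → ℝ := fun X => θ X * ‖Φ.ψ X‖ with hGdef
  have hG : ContDiff ℝ 1 G := hθ.mul (contDiff_norm_of_real Φ hreal)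
  have hΨfun : Ψ.ψ = fun X => ((G X : ℝ) : ℂ) := funext hΨ
  -- pointwise integrand
  have hpt : ∀ X, kineticDensity Ψ.ψ X + periodicInteraction w L X * ((‖Ψ.ψ X‖₊ : ℝ≥0∞)) ^ 2 =
      ENNReal.ofReal (gradDot G G X) + periodicInteraction w L X * ENNReal.ofReal (G X ^ 2) := by
    intro X
    rw [hΨfun, kineticDensity_ofReal_eq_gradDot (hG.differentiable one_ne_zero)]
    dsimp only
    rw [coe_nnnorm_sq_eq_ofReal, Complex.norm_real, Real.norm_eq_abs, sq_abs]
  -- `θ` is bounded on the cell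
  obtain ⟨M, -, hM⟩ := exists_bound_on_cellN hθ.continuous L
  -- integrability of the two real densities
  have hint1 : IntegrableOn (fun X => gradDot G G X) (cellN N L) :=
    integrableOn_cellN (continuous_gradDot hG hG) L
  have hint2 : IntegrableOn (fun X => (periodicInteraction w L X).toReal * G X ^ 2) (cellN N L) := by
    have h0 := integrableOn_toReal_interaction_mul_norm_sq (Φ := Φ) hw hfin
    have hfun : (fun X => (periodicInteraction w L X).toReal * G X ^ 2) =
        fun X => θ X ^ 2 * ((periodicInteraction w L X).toReal * ‖Φ.ψ X‖ ^ 2) := by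
      funext X; simp only [hGdef]; ring
    rw [hfun]
    refine Integrable.bdd_mul h0 ((hθ.continuous.pow 2).aestronglyMeasurable) (c := M ^ 2) ?_
    rw [ae_restrict_iff' (measurableSet_cellN N L)]
    refine ae_of_all _ fun X hX => ?_
    rw [Real.norm_eq_abs, abs_pow]
    have h1 := hM X hX
    have h2 := abs_nonneg (θ X)
    nlinarith
  unfold periodicEnergy
  simp_rw [hpt]
  rw [lintegral_add_left (continuous_gradDot hG hG).measurable.ennreal_ofReal]
  have e1 : ∫⁻ X in cellN N L, ENNReal.ofReal (gradDot G G X) =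
      ENNReal.ofReal (∫ X in cellN N L, gradDot G G X) :=
    (ofReal_integral_eq_lintegral_ofReal hint1 (ae_of_all _ fun X => gradDot_self_nonneg G X)).symm
  have e2 : ∫⁻ X in cellN N L, periodicInteraction w L X * ENNReal.ofReal (G X ^ 2) =
      ENNReal.ofReal (∫ X in cellN N L, (periodicInteraction w L X).toReal * G X ^ 2) := by
    rw [ofReal_integral_eq_lintegral_ofReal hint2
      (ae_of_all _ fun X => mul_nonneg ENNReal.toReal_nonneg (sq_nonneg _))]
    refine lintegral_congr_ae ?_
    filter_upwards [ae_periodicInteraction_lt_top hw hpos hfin] with X hX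
    rw [ENNReal.ofReal_mul ENNReal.toReal_nonneg, ENNReal.ofReal_toReal hX.ne]
  rw [e1, e2, ← ENNReal.ofReal_add (integral_nonneg fun X => gradDot_self_nonneg G X)
    (integral_nonneg fun X => mul_nonneg ENNReal.toReal_nonneg (sq_nonneg _))]

/-- In the setting of `periodicEnergy_eq_ofReal_of_eq_mul` the energy of `Ψ` is finite. [folklore] -/
theorem periodicEnergy_ne_top_of_eq_mul (hw : Measurable w) (hreal : ∀ X, Φ.ψ X = (‖Φ.ψ X‖ : ℂ))
    (hpos : ∀ X, Φ.ψ X ≠ 0) (hfin : periodicEnergy w Φ ≠ ⊤) (Ψ : PeriodicTrialState N L)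
    {θ : Config N → ℝ} (hθ : ContDiff ℝ 1 θ) (hΨ : ∀ X, Ψ.ψ X = ((θ X * ‖Φ.ψ X‖ : ℝ) : ℂ)) :
    periodicEnergy w Ψ ≠ ⊤ := by
  rw [periodicEnergy_eq_ofReal_of_eq_mul hw hreal hpos hfin Ψ hθ hΨ]
  exact ENNReal.ofReal_ne_top

/-- In the setting of `periodicEnergy_eq_ofReal_of_eq_mul`, the real form of the energy. [folklore] -/
theorem toReal_periodicEnergy_of_eq_mul (hw : Measurable w) (hreal : ∀ X, Φ.ψ X = (‖Φ.ψ X‖ : ℂ))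
    (hpos : ∀ X, Φ.ψ X ≠ 0) (hfin : periodicEnergy w Φ ≠ ⊤) (Ψ : PeriodicTrialState N L)
    {θ : Config N → ℝ} (hθ : ContDiff ℝ 1 θ) (hΨ : ∀ X, Ψ.ψ X = ((θ X * ‖Φ.ψ X‖ : ℝ) : ℂ)) :
    (periodicEnergy w Ψ).toReal =
      (∫ X in cellN N L, gradDot (fun Y => θ Y * ‖Φ.ψ Y‖) (fun Y => θ Y * ‖Φ.ψ Y‖) X) +
        ∫ X in cellN N L, (periodicInteraction w L X).toReal * (θ X * ‖Φ.ψ X‖) ^ 2 := by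
  rw [periodicEnergy_eq_ofReal_of_eq_mul hw hreal hpos hfin Ψ hθ hΨ, ENNReal.toReal_ofReal]
  exact add_nonneg (integral_nonneg fun X => gradDot_self_nonneg _ X)
    (integral_nonneg fun X => mul_nonneg ENNReal.toReal_nonneg (sq_nonneg _))

/-- The density wave mean of `Ψ = θ|Φ|`: `⟨∑cos⟩_Ψ = ∫ (∑ⱼ cos(p·xⱼ)) θ² |Φ|²`. [folklore] -/
theorem cosMean_of_eq_mul (k : Fin 3 → ℤ) (Ψ : PeriodicTrialState N L) {θ : Config N → ℝ}
    (hΨ : ∀ X, Ψ.ψ X = ((θ X * ‖Φ.ψ X‖ : ℝ) : ℂ)) :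
    cosMean L k Ψ = ∫ X in cellN N L,
      (∑ j, Real.cos (2 * Real.pi / L * ∑ i, (k i : ℝ) * X j i)) * (θ X * ‖Φ.ψ X‖) ^ 2 := by
  unfold cosMean
  congr 1 with X
  rw [hΨ X, Complex.norm_real, Real.norm_eq_abs, sq_abs]

/-- The normalisation of `Ψ = θ|Φ|` in real form: `∫ θ²|Φ|² = 1`. [folklore] -/
theorem integral_sq_mul_norm_sq_of_eq_mul (Ψ : PeriodicTrialState N L) {θ : Config N → ℝ}
    (hΨ : ∀ X, Ψ.ψ X = ((θ X * ‖Φ.ψ X‖ : ℝ) : ℂ)) :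
    ∫ X in cellN N L, (θ X * ‖Φ.ψ X‖) ^ 2 = 1 := by
  rw [← integral_norm_sq_eq_one Ψ]
  congr 1 with X
  rw [hΨ X, Complex.norm_real, Real.norm_eq_abs, sq_abs]

end RealForm

/-! ### Second-order expansions along a perturbation `(1 + εζ)F` -/

section Expansion

/-- `∫ U ((1+εζ)F)² = ∫ U F² + 2ε ∫ U ζ F² + ε² ∫ U ζ² F²` (given integrability). [folklore] -/
theorem integral_mul_perturb_sq {U ζ F : Config N → ℝ} (ε : ℝ)
    (h0 : IntegrableOn (fun X => U X * F X ^ 2) (cellN N L))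
    (h1 : IntegrableOn (fun X => U X * ζ X * F X ^ 2) (cellN N L))
    (h2 : IntegrableOn (fun X => U X * ζ X ^ 2 * F X ^ 2) (cellN N L)) :
    ∫ X in cellN N L, U X * ((1 + ε * ζ X) * F X) ^ 2 =
      (∫ X in cellN N L, U X * F X ^ 2) + 2 * ε * (∫ X in cellN N L, U X * ζ X * F X ^ 2) +
        ε ^ 2 * ∫ X in cellN N L, U X * ζ X ^ 2 * F X ^ 2 := by
  have hpt : ∀ X, U X * ((1 + ε * ζ X) * F X) ^ 2 =
      U X * F X ^ 2 + 2 * ε * (U X * ζ X * F X ^ 2) + ε ^ 2 * (U X * ζ X ^ 2 * F X ^ 2) :=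
    fun X => by ring
  simp_rw [hpt]
  have hA : Integrable (fun X => U X * F X ^ 2 + 2 * ε * (U X * ζ X * F X ^ 2))
      (volume.restrict (cellN N L)) := h0.add (h1.const_mul _)
  rw [integral_add hA (h2.const_mul _), integral_add h0 (h1.const_mul _),
    integral_const_mul, integral_const_mul]

/-- `∫ |∇((1+εζ)F)|² = ∫ |∇F|² + 2ε ∫ ∇F·∇(ζF) + ε² ∫ |∇(ζF)|²` for `C¹` data. [folklore] -/
theorem integral_gradDot_perturb {ζ F : Config N → ℝ} (hζ : ContDiff ℝ 1 ζ) (hF : ContDiff ℝ 1 F)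
    (ε L : ℝ) :
    ∫ X in cellN N L, gradDot (fun Y => (1 + ε * ζ Y) * F Y) (fun Y => (1 + ε * ζ Y) * F Y) X =
      (∫ X in cellN N L, gradDot F F X) +
        2 * ε * (∫ X in cellN N L, gradDot F (fun Y => ζ Y * F Y) X) +
        ε ^ 2 * ∫ X in cellN N L, gradDot (fun Y => ζ Y * F Y) (fun Y => ζ Y * F Y) X := by
  have hH : ContDiff ℝ 1 fun Y => ζ Y * F Y := hζ.mul hF
  have hfun : (fun Y => (1 + ε * ζ Y) * F Y) = F + ε • fun Y => ζ Y * F Y := by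
    funext Y; simp only [Pi.add_apply, Pi.smul_apply, smul_eq_mul]; ring
  have hpt : ∀ X, gradDot (fun Y => (1 + ε * ζ Y) * F Y) (fun Y => (1 + ε * ζ Y) * F Y) X =
      gradDot F F X + 2 * ε * gradDot F (fun Y => ζ Y * F Y) X +
        ε ^ 2 * gradDot (fun Y => ζ Y * F Y) (fun Y => ζ Y * F Y) X := by
    intro X
    rw [hfun, gradDot_add_add (hF.differentiable one_ne_zero X)
      ((hH.differentiable one_ne_zero X).const_smul ε),
      gradDot_smul_right, gradDot_smul_left, gradDot_smul_right]
    ring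
  simp_rw [hpt]
  have i0 := integrableOn_cellN (continuous_gradDot hF hF) L
  have i1 := integrableOn_cellN (continuous_gradDot hF hH) L
  have i2 := integrableOn_cellN (continuous_gradDot hH hH) L
  have hA : Integrable (fun X => gradDot F F X + 2 * ε * gradDot F (fun Y => ζ Y * F Y) X)
      (volume.restrict (cellN N L)) := i0.add (i1.const_mul _)
  rw [integral_add hA (i2.const_mul _), integral_add i0 (i1.const_mul _),
    integral_const_mul, integral_const_mul]

end Expansion

/-! ### The normalised perturbed states `(1 + εζ)Φ/‖(1 + εζ)Φ‖` -/

section Perturbation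

variable {w : ℝ → ℝ≥0∞} {Φ : PeriodicTrialState N L}

/-- **Admissible perturbations.** For a real nonnegative non-vanishing periodic state `Φ` and a
real `C¹` lattice-periodic Bose-symmetric `ζ`, for all small `ε` the function `(1 + εζ)|Φ|`
normalised on the cell is an admissible periodic trial state `Ψ_ε = c_ε (1 + εζ)|Φ|`, `c_ε > 0`
(`PeriodicTrialState.ofFun`). [folklore] -/
theorem exists_perturbedState (hL : 0 < L) (hreal : ∀ X, Φ.ψ X = (‖Φ.ψ X‖ : ℂ))
    (hpos : ∀ X, Φ.ψ X ≠ 0) {ζ : Config N → ℝ} (hζ : ContDiff ℝ 1 ζ)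
    (hζper : IsLatticePeriodic L ζ)
    (hζsymm : ∀ (σ : Equiv.Perm (Fin N)) (X : Config N), ζ (X ∘ σ) = ζ X) :
    ∃ ε₀ : ℝ, 0 < ε₀ ∧ ∀ ε : ℝ, |ε| < ε₀ → ∃ Ψ : PeriodicTrialState N L, ∃ c : ℝ, 0 < c ∧
      ∀ X, Ψ.ψ X = ((c * (1 + ε * ζ X) * ‖Φ.ψ X‖ : ℝ) : ℂ) := by
  set X₀ : Config N := fun _ => (WithLp.toLp 2 fun _ : Fin 3 => L / 2 : Space) with hX₀def
  refine ⟨1 / (|ζ X₀| + 1), by positivity, fun ε hε => ?_⟩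
  set ψε : Config N → ℂ := fun X => (((1 + ε * ζ X) * ‖Φ.ψ X‖ : ℝ) : ℂ) with hψε
  have hF : ContDiff ℝ 1 fun X => ‖Φ.ψ X‖ := contDiff_norm_of_real Φ hreal
  have hGc : ContDiff ℝ 1 fun X => (1 + ε * ζ X) * ‖Φ.ψ X‖ :=
    (contDiff_const.add (contDiff_const.mul hζ)).mul hF
  have hC : ContDiff ℝ 1 ψε := Complex.ofRealCLM.contDiff.comp hGc
  have hper : ∀ (X : Config N) (i : Fin N) (a : Fin 3),
      ψε (X + Pi.single i (EuclideanSpace.single a L)) = ψε X := by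
    intro X i a; simp only [hψε, hζper X i a, Φ.periodic X i a]
  have hsymm : ∀ (σ : Equiv.Perm (Fin N)) (X : Config N), ψε (X ∘ σ) = ψε X := by
    intro σ X; simp only [hψε, hζsymm σ X, Φ.symm σ X]
  -- the perturbed function does not vanish at the centre of the cell
  have h1ε : 0 < 1 + ε * ζ X₀ := by
    have h1 : |ε| * |ζ X₀| < 1 := by
      have hz : 0 ≤ |ζ X₀| := abs_nonneg _
      calc |ε| * |ζ X₀| ≤ 1 / (|ζ X₀| + 1) * |ζ X₀| :=
            mul_le_mul_of_nonneg_right hε.le hz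
        _ < 1 := by
            rw [div_mul_eq_mul_div, one_mul, div_lt_one (by positivity)]; linarith
    rw [← abs_mul] at h1
    linarith [neg_abs_le (ε * ζ X₀)]
  have hX₀ : ∀ (i : Fin N) (a : Fin 3), (X₀ i).ofLp a ∈ Set.Ioo 0 L := by
    intro i a
    simp only [hX₀def, WithLp.ofLp_toLp, Set.mem_Ioo]
    constructor <;> linarith
  have hne : ψε X₀ ≠ 0 := by
    simp only [hψε, ne_eq, Complex.ofReal_eq_zero, mul_eq_zero, norm_eq_zero, not_or]
    exact ⟨h1ε.ne', hpos X₀⟩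
  have h0 : ∫⁻ X in cellN N L, ((‖ψε X‖₊ : ℝ≥0∞)) ^ 2 ≠ 0 :=
    (lintegral_cellN_pos hC.continuous hX₀ hne).ne'
  have htop : ∫⁻ X in cellN N L, ((‖ψε X‖₊ : ℝ≥0∞)) ^ 2 ≠ ⊤ := by
    have hint := integrableOn_cellN (f := fun X => ‖ψε X‖ ^ 2) (hC.continuous.norm.pow 2) L
    refine ne_of_lt (lt_of_le_of_lt (le_of_eq (lintegral_congr fun X => ?_)) hint.2)
    rw [coe_nnnorm_sq_eq_ofReal, Real.enorm_eq_ofReal (sq_nonneg _)]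
  refine ⟨PeriodicTrialState.ofFun ψε hC hper hsymm h0 htop,
    (Real.sqrt (∫⁻ X in cellN N L, ((‖ψε X‖₊ : ℝ≥0∞)) ^ 2).toReal)⁻¹,
    inv_pos.2 (Real.sqrt_pos.2 (ENNReal.toReal_pos h0 htop)), fun X => ?_⟩
  rw [PeriodicTrialState.ofFun_apply]
  simp only [hψε]
  push_cast
  ring

/-- **Energy of a perturbed state.** For `Ψ = c(1 + εζ)|Φ|` admissible:
`E_w(Ψ) < ∞`, `E_w(Ψ) + s⟨∑cos⟩_Ψ = c² (∫|∇G_ε|² + ∫ W G_ε² + s ∫ (∑cos) G_ε²)` and `c² ∫ G_ε² = 1`,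
where `G_ε = (1 + εζ)|Φ|`. [folklore] -/
theorem energy_perturbedState (hw : Measurable w) (hreal : ∀ X, Φ.ψ X = (‖Φ.ψ X‖ : ℂ))
    (hpos : ∀ X, Φ.ψ X ≠ 0) (hfin : periodicEnergy w Φ ≠ ⊤) (k : Fin 3 → ℤ) (s ε : ℝ)
    {ζ : Config N → ℝ} (hζ : ContDiff ℝ 1 ζ) (Ψ : PeriodicTrialState N L) {c : ℝ}
    (hΨ : ∀ X, Ψ.ψ X = ((c * (1 + ε * ζ X) * ‖Φ.ψ X‖ : ℝ) : ℂ)) :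
    periodicEnergy w Ψ ≠ ⊤ ∧
    (periodicEnergy w Ψ).toReal + s * cosMean L k Ψ = c ^ 2 *
      ((∫ X in cellN N L, gradDot (fun Y => (1 + ε * ζ Y) * ‖Φ.ψ Y‖)
          (fun Y => (1 + ε * ζ Y) * ‖Φ.ψ Y‖) X) +
        (∫ X in cellN N L, (periodicInteraction w L X).toReal * ((1 + ε * ζ X) * ‖Φ.ψ X‖) ^ 2) +
        s * ∫ X in cellN N L, (∑ j, Real.cos (2 * Real.pi / L * ∑ i, (k i : ℝ) * X j i)) *
          ((1 + ε * ζ X) * ‖Φ.ψ X‖) ^ 2) ∧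
    c ^ 2 * ∫ X in cellN N L, ((1 + ε * ζ X) * ‖Φ.ψ X‖) ^ 2 = 1 := by
  set θ : Config N → ℝ := fun X => c * (1 + ε * ζ X) with hθdef
  have hθ : ContDiff ℝ 1 θ := contDiff_const.mul (contDiff_const.add (contDiff_const.mul hζ))
  have hΨ' : ∀ X, Ψ.ψ X = ((θ X * ‖Φ.ψ X‖ : ℝ) : ℂ) := fun X => by rw [hΨ X]
  have hfun : (fun Y => θ Y * ‖Φ.ψ Y‖) = c • fun Y => (1 + ε * ζ Y) * ‖Φ.ψ Y‖ := by
    funext Y; simp only [hθdef, Pi.smul_apply, smul_eq_mul]; ring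
  have hsq : ∀ X, (θ X * ‖Φ.ψ X‖) ^ 2 = c ^ 2 * ((1 + ε * ζ X) * ‖Φ.ψ X‖) ^ 2 := fun X => by
    simp only [hθdef]; ring
  refine ⟨periodicEnergy_ne_top_of_eq_mul hw hreal hpos hfin Ψ hθ hΨ', ?_, ?_⟩
  · rw [toReal_periodicEnergy_of_eq_mul hw hreal hpos hfin Ψ hθ hΨ', cosMean_of_eq_mul k Ψ hΨ',
      hfun]
    simp_rw [gradDot_smul_left, gradDot_smul_right, hsq]
    simp_rw [← mul_assoc, mul_comm _ (c ^ 2), mul_assoc, integral_const_mul]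
    ring
  · rw [← integral_const_mul]
    simp_rw [← hsq]
    exact integral_sq_mul_norm_sq_of_eq_mul Ψ hΨ'

end Perturbation

/-- **Registered form (sub-goal `stub_modulationRealForm` of stub S3).** The real Bochner form of
the energy of `Ψ = θ|Φ|` for a positive real finite-energy `Φ` and real `C¹` `θ`
(`periodicEnergy_eq_ofReal_of_eq_mul`, closed statement). [folklore] -/
theorem stub_modulationRealForm :
    ∀ (w : ℝ → ℝ≥0∞), Measurable w → ∀ (N : ℕ) (L : ℝ) (Φ Ψ : PeriodicTrialState N L)
      (θ : Config N → ℝ), (∀ X, Φ.ψ X = (‖Φ.ψ X‖ : ℂ)) → (∀ X, Φ.ψ X ≠ 0) →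
      periodicEnergy w Φ ≠ ⊤ → ContDiff ℝ 1 θ → (∀ X, Ψ.ψ X = ((θ X * ‖Φ.ψ X‖ : ℝ) : ℂ)) →
      periodicEnergy w Ψ = ENNReal.ofReal
        ((∫ X in cellN N L, gradDot (fun Y => θ Y * ‖Φ.ψ Y‖) (fun Y => θ Y * ‖Φ.ψ Y‖) X) +
          ∫ X in cellN N L, (periodicInteraction w L X).toReal * (θ X * ‖Φ.ψ X‖) ^ 2) :=
  fun _w hw _N _L _Φ Ψ _θ hreal hpos hfin hθ hΨ =>
    periodicEnergy_eq_ofReal_of_eq_mul hw hreal hpos hfin Ψ hθ hΨ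

end Summit.AtomisticToContinuum.BoseEinsteinCondensation.Cruxes.StaticResponseBound.UvThomsonForceWave

end
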